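import Summits.CriticalPhenomena.CardyFormulaZ2.Theorems.CardyUniqueLimitCardyRigidityFaceHalfPlaneG2FarCrosscut
import Literature.Probability.RandomPlanarGeometry.LoewnerDescriptionProofs
import HarnessLib

/-!
# The round annulus of the single-annulus transfer (input (T1) of `PercFaceAnnulusTransfer`)

Crux `Summit.CriticalPhenomena.CardyFormulaZ2.Theses.CardyUniqueLimit.CardyRigidity`
(stmt-CriticalPhenomena-0746), line `crossing_martingale`, stub A2‴ `stub_percFaceAnnulusTransfer :
Driver.PercFaceAnnulusTransfer` (`…FaceHalfPlaneG2OfTransfer.lean`), input (T1): Kemppainen–Smirnov's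
single-annulus transfer (Ann. Probab. 45 (2017), §2.2, proof of Prop. 2.6, "(G2) ⇒ (C2)") for the
chordal maps `Φ_k = (φs k).boundaryExtension` of the approximating domains.  Its analytic heart (a
far level cross-cut, by length–area) is LANDED (`FarCrosscut.exists_forall_lt_dist`); this file is
the wrap-up:

* `RoundAnnulus.exists_window` — a continuous real function on `[a, b]` taking the values `p`, `q`
  takes them at two times between which it stays in `[p ⊓ q, p ⊔ q]` (first/last passages);
* `RoundAnnulus.exists_crossing_window` — **every half-annulus crossing crosses the round annulus,
  inside a window**: if `Φ(S̄(c, s₀)) ⊆ B̄(x, d)` and `Φ(S̄(c, u₁)) ∩ B(x, K) = ∅`, every continuous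
  curve of the closed half-plane visiting `B̄(c, s₀ ⊓ u₁)` and `{|z - c| ≥ s₀ ⊔ u₁}` has two times,
  one mapped into `B̄(x, d)` and one off `B(x, K)`, between which `s₀ ⊓ u₁ ≤ |z - c| ≤ s₀ ⊔ u₁`
  (intermediate values of `|· - c|`; no planar topology);
* **`RoundAnnulus.eventually_exists_crosscuts`** / anchor `faceAnnulus_eventually_exists_crosscuts` —
  given `U1` (uniform convergence `Φ_k → Φ = φ.boundaryExtension` on compact parts of `ℍ̄`, `φ` a
  chordal map of the Jordan domain `D`), `0 < r`, `1 < C`, `0 ≤ C'` with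
  `log C > 2π²/log(4/3) + 36π²(C'+1)²`, and `Z`: there is `d₀ > 0` such that for all large `k`
  and every real `|c| ≤ Z` there are `x` (image of an interior point), `d ≥ d₀` and
  `s₀, u₁ ∈ (r, Cr)` with `Φ_k(S̄(c, s₀)) ⊆ B̄(x, d)`, `Φ_k(S̄(c, u₁)) ∩ B(x, (C'+1) d) = ∅`.  PROOF:
  `d` is a near-minimal diameter of the images of the closed semicircles `S̄(c, s)`, `s ∈ (r, Cr)`
  (so every image has two points of the open arc `d/2` apart, and one image lies in `B̄(x, d)`),
  bounded below by the minimum over the compact set of `(c, s)` of the distance of the `Φ`-images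
  of two interior points (injectivity of `Φ`), transferred to `Φ_k` by `U1`; the far level is
  `FarCrosscut.exists_forall_lt_dist`, extended to the closed semicircle by continuity.

References: A. Kemppainen, S. Smirnov, Ann. Probab. 45 (2017) 698–779, §2.2 (proof of Prop. 2.6)
[KemppainenSmirnov2017]; Ch. Pommerenke, *Boundary Behaviour of Conformal Maps* (1992), Thm. 2.6
[PommerenkeBBCM1992].
-/

noncomputable section

open Set Filter Metric Topology Complex Real
open UpperHalfPlane (upperHalfPlaneSet isOpen_upperHalfPlaneSet)
open scoped NNReal
open Literature.Analysis.Complex.AnnulusCrossing (circleMap_mem_upperHalfPlaneSet circleMap_ofReal_im)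
open Literature.Probability.RandomPlanarGeometry

namespace Summit.CriticalPhenomena.CardyFormulaZ2.Cruxes.CardyRigidity.CrossingMartingale

namespace RoundAnnulus

/-! ### Closed semicircles about a real centre -/

/-- The closed upper semicircle about a real centre lies in the closed half-plane. [folklore] -/
theorem circleMap_im_nonneg (c : ℝ) {u θ : ℝ} (hu : 0 ≤ u) (hθ : θ ∈ Icc 0 π) :
    0 ≤ (circleMap (c : ℂ) u θ).im := by
  rw [circleMap_ofReal_im]
  exact mul_nonneg hu (Real.sin_nonneg_of_nonneg_of_le_pi hθ.1 hθ.2)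

/-- Points of the upper semicircle of radius `u ≥ 0` about `c` have norm `≤ |c| + u`. [folklore] -/
theorem norm_circleMap_le (c : ℝ) {u : ℝ} (hu : 0 ≤ u) (θ : ℝ) :
    ‖circleMap (c : ℂ) u θ‖ ≤ |c| + u := by
  have h1 : ‖circleMap (c : ℂ) u θ - c‖ = u := by
    rw [← dist_eq_norm]; simpa only [mem_sphere] using circleMap_mem_sphere (c : ℂ) hu θ
  calc ‖circleMap (c : ℂ) u θ‖ = ‖(circleMap (c : ℂ) u θ - c) + c‖ := by rw [sub_add_cancel]
    _ ≤ ‖circleMap (c : ℂ) u θ - c‖ + ‖(c : ℂ)‖ := norm_add_le _ _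
    _ = |c| + u := by rw [h1, Complex.norm_real, Real.norm_eq_abs, add_comm]

/-- A point of the closed upper half-plane at distance `s` from the real point `c` lies on the
closed upper semicircle of radius `s` about `c`. [folklore] -/
theorem exists_mem_Icc_circleMap_eq {z : ℂ} {c s : ℝ} (hz : 0 ≤ z.im) (hs : dist z c = s) :
    ∃ θ ∈ Icc (0 : ℝ) π, circleMap (c : ℂ) s θ = z := by
  refine ⟨arg (z - c), ⟨Complex.arg_nonneg_iff.2 (by simpa using hz), arg_le_pi _⟩, ?_⟩
  have h1 : (s : ℂ) = (‖z - c‖ : ℂ) := by rw [← dist_eq_norm, hs]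
  rw [circleMap, h1, norm_mul_exp_arg_mul_I, add_sub_cancel]

/-! ### Continuity on the closed semicircle: values on the open arc control the closed arc -/

/-- A strict lower bound for a continuous function of the OPEN upper semicircle is a weak lower
bound on the CLOSED one. [folklore] -/
theorem le_of_forall_Ioo {h : ℝ → ℝ} (hh : ContinuousOn h (Icc 0 π)) {K : ℝ}
    (hK : ∀ θ ∈ Ioo (0 : ℝ) π, K < h θ) {θ : ℝ} (hθ : θ ∈ Icc (0 : ℝ) π) : K ≤ h θ := by
  have hcl : IsClosed (Icc (0 : ℝ) π ∩ h ⁻¹' Ici K) :=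
    hh.preimage_isClosed_of_isClosed isClosed_Icc isClosed_Ici
  have hsub : Ioo (0 : ℝ) π ⊆ Icc (0 : ℝ) π ∩ h ⁻¹' Ici K :=
    fun θ' hθ' ↦ ⟨Ioo_subset_Icc_self hθ', (hK θ' hθ').le⟩
  exact ((hcl.closure_subset_iff.2 hsub) (by rw [closure_Ioo pi_pos.ne]; exact hθ)).2

/-- Every value of a continuous function on the closed semicircle is approximated by values on
the open arc. [folklore] -/
theorem exists_Ioo_dist_lt {X : Type*} [PseudoMetricSpace X] {h : ℝ → X}
    (hh : ContinuousOn h (Icc 0 π)) {θ : ℝ} (hθ : θ ∈ Icc (0 : ℝ) π) {ε : ℝ} (hε : 0 < ε) :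
    ∃ θ' ∈ Ioo (0 : ℝ) π, dist (h θ') (h θ) < ε := by
  have hne : (𝓝[Ioo (0 : ℝ) π] θ).NeBot :=
    mem_closure_iff_nhdsWithin_neBot.1 (by rw [closure_Ioo pi_pos.ne]; exact hθ)
  have ht : Tendsto h (𝓝[Ioo (0 : ℝ) π] θ) (𝓝 (h θ)) :=
    (hh.continuousWithinAt hθ).mono_left (nhdsWithin_mono _ Ioo_subset_Icc_self)
  obtain ⟨θ', h1, h2⟩ := (((Metric.tendsto_nhds.1 ht) ε hε).and self_mem_nhdsWithin).exists
  exact ⟨θ', h2, h1⟩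

/-! ### First and last passages: a window between two levels -/

/-- **A window between two levels.** A continuous real function `g` on `[a, b]` taking the value
`p` at `tp` and `q` at `tq ≥ tp` takes them at two times `t₁ ≤ t₂` of `[tp, tq]` between which it
stays in `[p ⊓ q, p ⊔ q]` (the first passage at `q` after `tp`, and the last passage at `p`
before it). [folklore] -/
theorem exists_window_of_le {g : ℝ → ℝ} {a b : ℝ} (hg : ContinuousOn g (Icc a b)) {p q tp tq : ℝ}
    (htp : tp ∈ Icc a b) (htq : tq ∈ Icc a b) (hle : tp ≤ tq) (hgp : g tp = p) (hgq : g tq = q) :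
    ∃ t₁ ∈ Icc a b, ∃ t₂ ∈ Icc a b, t₁ ≤ t₂ ∧ g t₁ = p ∧ g t₂ = q ∧
      ∀ t ∈ Icc t₁ t₂, g t ∈ uIcc p q := by
  -- the first passage at `q` after `tp`
  set Sq : Set ℝ := Icc tp tq ∩ g ⁻¹' {q} with hSq
  have hgq' : ContinuousOn g (Icc tp tq) := hg.mono (Icc_subset_Icc htp.1 htq.2)
  have hSqc : IsClosed Sq := hgq'.preimage_isClosed_of_isClosed isClosed_Icc isClosed_singleton
  have hSqne : Sq.Nonempty := ⟨tq, ⟨hle, le_rfl⟩, hgq⟩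
  have hSqbdd : BddBelow Sq := ⟨tp, fun t ht ↦ ht.1.1⟩
  set t₂ := sInf Sq with ht₂
  have ht₂mem : t₂ ∈ Sq := hSqc.csInf_mem hSqne hSqbdd
  have ht₂min : ∀ t ∈ Sq, t₂ ≤ t := fun t ht ↦ csInf_le hSqbdd ht
  -- the last passage at `p` before `t₂`
  set Sp : Set ℝ := Icc tp t₂ ∩ g ⁻¹' {p} with hSp
  have hgp' : ContinuousOn g (Icc tp t₂) := hg.mono (Icc_subset_Icc htp.1 (ht₂mem.1.2.trans htq.2))
  have hSpc : IsClosed Sp := hgp'.preimage_isClosed_of_isClosed isClosed_Icc isClosed_singleton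
  have hSpne : Sp.Nonempty := ⟨tp, ⟨le_rfl, ht₂mem.1.1⟩, hgp⟩
  have hSpbdd : BddAbove Sp := ⟨t₂, fun t ht ↦ ht.1.2⟩
  set t₁ := sSup Sp with ht₁
  have ht₁mem : t₁ ∈ Sp := hSpc.csSup_mem hSpne hSpbdd
  have ht₁max : ∀ t ∈ Sp, t ≤ t₁ := fun t ht ↦ le_csSup hSpbdd ht
  have h12 : t₁ ≤ t₂ := ht₁mem.1.2
  have ht₁ab : t₁ ∈ Icc a b := ⟨htp.1.trans ht₁mem.1.1, h12.trans (ht₂mem.1.2.trans htq.2)⟩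
  have ht₂ab : t₂ ∈ Icc a b := ⟨ht₁ab.1.trans h12, ht₂mem.1.2.trans htq.2⟩
  have hg12 : ContinuousOn g (Icc t₁ t₂) := hg.mono (Icc_subset_Icc ht₁ab.1 ht₂ab.2)
  refine ⟨t₁, ht₁ab, t₂, ht₂ab, h12, ht₁mem.2, ht₂mem.2, fun t ht ↦ ?_⟩
  -- no passage at `q` strictly before `t₂`, none at `p` strictly after `t₁`, inside the window
  have noq : ∀ t' ∈ Icc t₁ t₂, g t' = q → t' = t₂ := by
    intro t' ht' hq
    have : t' ∈ Sq := ⟨⟨ht₁mem.1.1.trans ht'.1, ht'.2.trans ht₂mem.1.2⟩, hq⟩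
    exact le_antisymm ht'.2 (ht₂min t' this)
  have nop : ∀ t' ∈ Icc t₁ t₂, g t' = p → t' = t₁ := by
    intro t' ht' hp
    have : t' ∈ Sp := ⟨⟨ht₁mem.1.1.trans ht'.1, ht'.2⟩, hp⟩
    exact le_antisymm (ht₁max t' this) ht'.1
  -- a passage at `p` in `[t, t₂]` happens at `t₁`, one at `q` in `[t₁, t]` at `t₂`
  have claim1 : p ∈ uIcc (g t) (g t₂) → g t = p := fun hp ↦ by
    obtain ⟨t', ht', hgt'⟩ := intermediate_value_uIcc (hg12.mono (by
      rw [uIcc_of_le ht.2]; exact Icc_subset_Icc ht.1 le_rfl)) hp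
    rw [uIcc_of_le ht.2] at ht'
    have h1 := nop t' ⟨ht.1.trans ht'.1, ht'.2⟩ hgt'
    rw [← hgt', h1, show t = t₁ from le_antisymm (h1 ▸ ht'.1) ht.1]
  have claim2 : q ∈ uIcc (g t₁) (g t) → g t = q := fun hq ↦ by
    obtain ⟨t', ht', hgt'⟩ := intermediate_value_uIcc (hg12.mono (by
      rw [uIcc_of_le ht.1]; exact Icc_subset_Icc le_rfl ht.2)) hq
    rw [uIcc_of_le ht.1] at ht'
    have h1 := noq t' ⟨ht'.1, ht'.2.trans ht.2⟩ hgt'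
    rw [← hgt', h1, show t = t₂ from le_antisymm ht.2 (h1 ▸ ht'.2)]
  rw [ht₁mem.2] at claim2
  rw [ht₂mem.2] at claim1
  by_contra hcon
  rcases le_total p q with hpq | hpq
  · rw [uIcc_of_le hpq, mem_Icc, not_and_or, not_le, not_le] at hcon
    rcases hcon with h | h
    · exact h.ne (claim1 (mem_uIcc.2 (Or.inl ⟨h.le, hpq⟩)))
    · exact h.ne' (claim2 (mem_uIcc.2 (Or.inl ⟨hpq, h.le⟩)))
  · rw [uIcc_of_ge hpq, mem_Icc, not_and_or, not_le, not_le] at hcon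
    rcases hcon with h | h
    · exact h.ne (claim2 (mem_uIcc.2 (Or.inr ⟨h.le, hpq⟩)))
    · exact h.ne' (claim1 (mem_uIcc.2 (Or.inr ⟨hpq, h.le⟩)))

/-- **A window between two levels** (either order of the passages): a continuous real function
on `[a, b]` taking the values `p` and `q` takes them at two times between which it stays in
`[p ⊓ q, p ⊔ q]`. [folklore] -/
theorem exists_window {g : ℝ → ℝ} {a b : ℝ} (hg : ContinuousOn g (Icc a b)) {p q tp tq : ℝ}
    (htp : tp ∈ Icc a b) (htq : tq ∈ Icc a b) (hgp : g tp = p) (hgq : g tq = q) :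
    ∃ t₁ ∈ Icc a b, ∃ t₂ ∈ Icc a b, g t₁ = p ∧ g t₂ = q ∧ ∀ t ∈ uIcc t₁ t₂, g t ∈ uIcc p q := by
  rcases le_total tp tq with hle | hle
  · obtain ⟨t₁, ht₁, t₂, ht₂, h12, hg₁, hg₂, hall⟩ := exists_window_of_le hg htp htq hle hgp hgq
    exact ⟨t₁, ht₁, t₂, ht₂, hg₁, hg₂, fun t ht ↦ hall t (by rwa [uIcc_of_le h12] at ht)⟩
  · obtain ⟨t₂, ht₂, t₁, ht₁, h21, hg₂, hg₁, hall⟩ := exists_window_of_le hg htq htp hle hgq hgp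
    refine ⟨t₁, ht₁, t₂, ht₂, hg₁, hg₂, fun t ht ↦ ?_⟩
    rw [uIcc_comm] at ht ⊢
    exact hall t (by rwa [uIcc_of_le h21] at ht)


/-! ### Every half-annulus crossing crosses the round annulus, inside a window -/

/-- **Every half-annulus crossing crosses the round annulus, inside a window.**  Let the closed
upper semicircle of radius `s₀` about the real point `c` be mapped by `f` into `B̄(x, d)` and
that of radius `u₁` off `B(x, K)`.  A continuous curve `η` of the closed half-plane on `[a, b]`
visiting `B̄(c, s₀ ⊓ u₁)` and `{|z - c| ≥ s₀ ⊔ u₁}` has two times, one mapped into `B̄(x, d)` and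
one off `B(x, K)`, between which it stays in the closed annulus `{s₀ ⊓ u₁ ≤ |z - c| ≤ s₀ ⊔ u₁}`
(intermediate values of `|η - c|`, first and last passages).
[cite: KemppainenSmirnov2017, §2.2 (proof of Prop. 2.6, (G2) ⇒ (C2))] -/
theorem exists_crossing_window {f : ℂ → ℂ} {c s₀ u₁ d K : ℝ} {x : ℂ}
    (hin : ∀ θ ∈ Icc (0 : ℝ) π, dist (f (circleMap (c : ℂ) s₀ θ)) x ≤ d)
    (hout : ∀ θ ∈ Icc (0 : ℝ) π, K ≤ dist (f (circleMap (c : ℂ) u₁ θ)) x)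
    {η : ℝ → ℂ} {a b : ℝ} (hη : ContinuousOn η (Icc a b))
    (him : ∀ t ∈ Icc a b, 0 ≤ (η t).im) {ta tb : ℝ} (hta : ta ∈ Icc a b) (htb : tb ∈ Icc a b)
    (hra : dist (η ta) c ≤ min s₀ u₁) (hRb : max s₀ u₁ ≤ dist (η tb) c) :
    ∃ t₁ ∈ Icc a b, ∃ t₂ ∈ Icc a b, dist (f (η t₁)) x ≤ d ∧ K ≤ dist (f (η t₂)) x ∧
      ∀ t ∈ uIcc t₁ t₂, dist (η t) c ∈ Icc (min s₀ u₁) (max s₀ u₁) := by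
  set g : ℝ → ℝ := fun t ↦ dist (η t) c with hg
  have hgc : ContinuousOn g (Icc a b) :=
    continuous_dist.comp_continuousOn (hη.prodMk continuousOn_const)
  have hsub : uIcc ta tb ⊆ Icc a b := uIcc_subset_Icc hta htb
  have hgc' : ContinuousOn g (uIcc ta tb) := hgc.mono hsub
  -- passages at the two levels
  have hs₀mem : s₀ ∈ uIcc (g ta) (g tb) :=
    mem_uIcc.2 (Or.inl ⟨hra.trans (min_le_left _ _), (le_max_left _ _).trans hRb⟩)
  have hu₁mem : u₁ ∈ uIcc (g ta) (g tb) :=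
    mem_uIcc.2 (Or.inl ⟨hra.trans (min_le_right _ _), (le_max_right _ _).trans hRb⟩)
  obtain ⟨tp, htp, hgtp⟩ := intermediate_value_uIcc hgc' hs₀mem
  obtain ⟨tq, htq, hgtq⟩ := intermediate_value_uIcc hgc' hu₁mem
  obtain ⟨t₁, ht₁, t₂, ht₂, hg₁, hg₂, hwin⟩ := exists_window hgc (hsub htp) (hsub htq) hgtp hgtq
  -- the two passages lie on the two closed semicircles
  obtain ⟨θ₁, hθ₁, hθ₁eq⟩ := exists_mem_Icc_circleMap_eq (him t₁ ht₁) hg₁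
  obtain ⟨θ₂, hθ₂, hθ₂eq⟩ := exists_mem_Icc_circleMap_eq (him t₂ ht₂) hg₂
  refine ⟨t₁, ht₁, t₂, ht₂, ?_, ?_, fun t ht ↦ hwin t ht⟩
  · rw [← hθ₁eq]; exact hin θ₁ hθ₁
  · rw [← hθ₂eq]; exact hout θ₂ hθ₂

/-! ### The two level cross-cuts, eventually along the approximating maps -/

/-- The boundary extension of a conformal map of `ℍ` onto a Dobrushin domain is continuous on the
closed half-plane, injective there, and holomorphic on `ℍ` (Carathéodory; Pommerenke Thm. 2.6).
[cite: PommerenkeBBCM1992, Thm. 2.6] -/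
theorem boundaryExtension_regular {D : DobrushinDomain}
    (φ : ConformalEquiv upperHalfPlaneSet D.carrier) :
    ContinuousOn φ.boundaryExtension {z : ℂ | 0 ≤ z.im} ∧
      InjOn φ.boundaryExtension {z : ℂ | 0 ≤ z.im} ∧
      DifferentiableOn ℂ φ.boundaryExtension upperHalfPlaneSet := by
  refine ⟨?_, JordanDomain.injOn_boundaryExtension φ, ?_⟩
  · have h := JordanDomain.continuousOn_boundaryExtension_holds D.toJordanDomain φ
    rwa [ConformalEquiv.closure_upperHalfPlaneSet_eq] at h
  · exact φ.differentiableOn.congr fun z hz ↦ φ.boundaryExtension_eq hz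

/-- **The two level cross-cuts, eventually along the approximating maps** (input (T1) of
`Driver.PercFaceAnnulusTransfer`, wrap-up of Kemppainen–Smirnov's single-annulus transfer).
Let `Φ_k = (φs k).boundaryExtension` converge to `Φ = φ.boundaryExtension` uniformly on compact
parts of the closed half-plane (`U1`), `φ` a chordal map of the Jordan domain `D`; let `0 < r`,
`1 < C`, `0 ≤ C'` with `log C > 2π²/log(4/3) + 36π²(C'+1)²`.  Then there is `d₀ > 0` such that
for all large `k` and every real centre `|c| ≤ Z` there are a point `x` (the image of an interior
point of a semicircle), a radius `d ≥ d₀` and two levels `s₀, u₁ ∈ (r, Cr)` with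
`Φ_k(S̄(c, s₀)) ⊆ B̄(x, d)` and `Φ_k(S̄(c, u₁)) ∩ B(x, (C'+1) d) = ∅`: `d` is a near-minimal
diameter of the images of the closed semicircles of radii in `(r, Cr)`, bounded below through
`U1` by the minimum over `(c, s)` of the distance of the `Φ`-images of two interior points, and
the far level is `FarCrosscut.exists_forall_lt_dist`.
[cite: KemppainenSmirnov2017, §2.2 (proof of Prop. 2.6, (G2) ⇒ (C2))] -/
theorem eventually_exists_crosscuts {D : DobrushinDomain}
    (φ : ConformalEquiv upperHalfPlaneSet D.carrier) {Ds : ℕ → DobrushinDomain}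
    (φs : ∀ k, ConformalEquiv upperHalfPlaneSet (Ds k).carrier)
    (hU1 : ∀ R : ℝ, TendstoUniformlyOn (fun k ↦ (φs k).boundaryExtension) φ.boundaryExtension
      atTop ({z : ℂ | 0 ≤ z.im} ∩ closedBall 0 R))
    {r C C' : ℝ} (hr : 0 < r) (hC1 : 1 < C) (hC' : 0 ≤ C')
    (hC : 2 * π ^ 2 / Real.log (4 / 3) + 36 * π ^ 2 * (C' + 1) ^ 2 < Real.log C) (Z : ℝ) :
    ∃ d₀ : ℝ, 0 < d₀ ∧ ∀ᶠ k in atTop, ∀ c : ℝ, |c| ≤ Z →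
      ∃ (x : ℂ) (d s₀ u₁ : ℝ), d₀ ≤ d ∧ s₀ ∈ Ioo r (C * r) ∧ u₁ ∈ Ioo r (C * r) ∧
        (∃ θ₀ ∈ Ioo (0 : ℝ) π, x = (φs k).boundaryExtension (circleMap (c : ℂ) s₀ θ₀)) ∧
        (∀ θ ∈ Icc (0 : ℝ) π, dist ((φs k).boundaryExtension (circleMap (c : ℂ) s₀ θ)) x ≤ d) ∧
        (∀ θ ∈ Icc (0 : ℝ) π,
          (C' + 1) * d ≤ dist ((φs k).boundaryExtension (circleMap (c : ℂ) u₁ θ)) x) := by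
  rcases lt_or_ge Z 0 with hZ | hZ
  · exact ⟨1, one_pos, Eventually.of_forall fun k c hc ↦ absurd (hc.trans_lt hZ) (abs_nonneg c).not_gt⟩
  obtain ⟨hΦc, hΦinj, -⟩ := boundaryExtension_regular φ
  set Φ := φ.boundaryExtension with hΦ
  have hrC : r < C * r := by nlinarith
  have hCr : 0 ≤ C * r := by nlinarith
  set P : ℝ × ℝ → ℂ := fun p ↦ circleMap (p.1 : ℂ) p.2 (π / 3) with hP
  set Q : ℝ × ℝ → ℂ := fun p ↦ circleMap (p.1 : ℂ) p.2 (π / 2) with hQ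
  have hPc : Continuous P := by simp only [hP, circleMap]; fun_prop
  have hQc : Continuous Q := by simp only [hQ, circleMap]; fun_prop
  have hπ3 : π / 3 ∈ Ioo (0 : ℝ) π := ⟨by positivity, by linarith [pi_pos]⟩
  have hπ2 : π / 2 ∈ Ioo (0 : ℝ) π := ⟨by positivity, by linarith [pi_pos]⟩
  set K : Set (ℝ × ℝ) := Icc (-Z) Z ×ˢ Icc r (C * r) with hK
  have hKc : IsCompact K := isCompact_Icc.prod isCompact_Icc
  have hKne : K.Nonempty := ⟨(0, r), ⟨⟨by linarith, hZ⟩, le_rfl, hrC.le⟩⟩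
  have hPim : ∀ p ∈ K, 0 ≤ (P p).im := fun p hp ↦
    circleMap_im_nonneg p.1 (hr.le.trans hp.2.1) (Ioo_subset_Icc_self hπ3)
  have hQim : ∀ p ∈ K, 0 ≤ (Q p).im := fun p hp ↦
    circleMap_im_nonneg p.1 (hr.le.trans hp.2.1) (Ioo_subset_Icc_self hπ2)
  -- the distance of the `Φ`-images, minimised over `K`
  set G : ℝ × ℝ → ℝ := fun p ↦ dist (Φ (P p)) (Φ (Q p)) with hG
  have hGc : ContinuousOn G K := by
    have h1 : ContinuousOn (fun p ↦ Φ (P p)) K := hΦc.comp hPc.continuousOn hPim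
    have h2 : ContinuousOn (fun p ↦ Φ (Q p)) K := hΦc.comp hQc.continuousOn hQim
    exact continuous_dist.comp_continuousOn (h1.prodMk h2)
  obtain ⟨p₀, hp₀, hmin⟩ := hKc.exists_isMinOn hKne hGc
  set d₁ : ℝ := G p₀ with hd₁
  have hPQ : ∀ p ∈ K, P p ≠ Q p := by
    intro p hp h
    have h1 := congrArg Complex.re h
    simp only [hP, hQ, circleMap, Complex.add_re, Complex.ofReal_re, Complex.mul_re, Complex.ofReal_im,
      Complex.exp_ofReal_mul_I_re, Complex.exp_ofReal_mul_I_im, Real.cos_pi_div_three,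
      Real.cos_pi_div_two] at h1
    have : 0 < p.2 := hr.trans_le hp.2.1
    linarith
  have hd₁pos : 0 < d₁ := by
    rw [hd₁, hG]
    exact dist_pos.2 fun h ↦ hPQ p₀ hp₀ (hΦinj (hPim p₀ hp₀) (hQim p₀ hp₀) h)
  -- `U1` on the closed half-disc of radius `Z + C r`
  have hU := Metric.tendstoUniformlyOn_iff.1 (hU1 (Z + C * r)) (d₁ / 8) (by positivity)
  refine ⟨3 * d₁ / 4, by positivity, ?_⟩
  filter_upwards [hU] with k hk c hc
  obtain ⟨hΦkc, hΦkinj, hΦkdiff⟩ := boundaryExtension_regular (φs k)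
  set Φk := (φs k).boundaryExtension with hΦk
  -- semicircles about `c` of radius `s ∈ [r, Cr]`: in the closed half-disc of radius `Z + C r`
  have hmemS : ∀ s ∈ Icc r (C * r), ∀ θ ∈ Icc (0 : ℝ) π,
      circleMap (c : ℂ) s θ ∈ {z : ℂ | 0 ≤ z.im} ∩ closedBall 0 (Z + C * r) := by
    intro s hs θ hθ
    refine ⟨circleMap_im_nonneg c (hr.le.trans hs.1) hθ, mem_closedBall_zero_iff.2 ?_⟩
    have := norm_circleMap_le c (hr.le.trans hs.1) θ
    have := abs_nonneg c
    linarith [hs.2]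
  set arc : ℝ → ℝ → ℂ := fun s θ ↦ Φk (circleMap (c : ℂ) s θ) with harc
  have harcc : ∀ s ∈ Icc r (C * r), ContinuousOn (arc s) (Icc 0 π) := fun s hs ↦
    hΦkc.comp (continuous_circleMap _ _).continuousOn fun θ hθ ↦ (hmemS s hs θ hθ).1
  have hbdd : ∀ s ∈ Icc r (C * r), Bornology.IsBounded (arc s '' Icc 0 π) := fun s hs ↦
    (isCompact_Icc.image_of_continuousOn (harcc s hs)).isBounded
  set Dk : ℝ → ℝ := fun s ↦ Metric.diam (arc s '' Icc 0 π) with hDk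
  -- lower bound of the diameters through `U1`
  have hlow : ∀ s ∈ Icc r (C * r), 3 * d₁ / 4 ≤ Dk s := by
    intro s hs
    have hpK : (c, s) ∈ K := ⟨⟨(abs_le.1 hc).1, (abs_le.1 hc).2⟩, hs⟩
    have hGp : d₁ ≤ G (c, s) := hmin hpK
    have h1 : dist (Φ (P (c, s))) (Φk (P (c, s))) < d₁ / 8 :=
      hk _ (hmemS s hs _ (Ioo_subset_Icc_self hπ3))
    have h2 : dist (Φ (Q (c, s))) (Φk (Q (c, s))) < d₁ / 8 :=
      hk _ (hmemS s hs _ (Ioo_subset_Icc_self hπ2))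
    have h3 := dist_triangle4 (Φ (P (c, s))) (Φk (P (c, s))) (Φk (Q (c, s))) (Φ (Q (c, s)))
    have h4 : dist (Φk (P (c, s))) (Φk (Q (c, s))) ≤ Dk s :=
      dist_le_diam_of_mem (hbdd s hs) (mem_image_of_mem _ (Ioo_subset_Icc_self hπ3))
        (mem_image_of_mem _ (Ioo_subset_Icc_self hπ2))
    change d₁ ≤ dist (Φ (P (c, s))) (Φ (Q (c, s))) at hGp
    rw [dist_comm] at h2
    linarith
  -- a near-minimal diameter over the open range of radii
  set S : Set ℝ := Dk '' Ioo r (C * r) with hS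
  have hSne : S.Nonempty := (nonempty_Ioo.2 hrC).image _
  have hSbdd : BddBelow S := ⟨0, by rintro _ ⟨s, -, rfl⟩; exact Metric.diam_nonneg⟩
  set m := sInf S with hm
  have hm_low : 3 * d₁ / 4 ≤ m :=
    le_csInf hSne (by rintro _ ⟨s, hs, rfl⟩; exact hlow s (Ioo_subset_Icc_self hs))
  have hmpos : 0 < m := by linarith
  obtain ⟨_, ⟨s₀, hs₀, rfl⟩, hs₀m⟩ := exists_lt_of_csInf_lt hSne (show sInf S < 4 / 3 * m by linarith)
  have hs₀' : s₀ ∈ Icc r (C * r) := Ioo_subset_Icc_self hs₀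
  set d := Dk s₀ with hd
  have hdlow : 3 * d₁ / 4 ≤ d := hlow s₀ hs₀'
  have hdpos : 0 < d := by linarith
  set x : ℂ := arc s₀ (π / 2) with hx
  -- the near cross-cut lies in `B̄(x, d)`
  have hin : ∀ θ ∈ Icc (0 : ℝ) π, dist (arc s₀ θ) x ≤ d := fun θ hθ ↦
    dist_le_diam_of_mem (hbdd s₀ hs₀') (mem_image_of_mem _ hθ)
      (mem_image_of_mem _ (Ioo_subset_Icc_self hπ2))
  -- every image arc has two points of the open arc `d/2` apart
  have hdiam : ∀ u ∈ Ioo r (C * r), ∃ θ' ∈ Ioo (0 : ℝ) π, ∃ θ'' ∈ Ioo (0 : ℝ) π,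
      d / 2 ≤ dist (Φk (circleMap (c : ℂ) u θ')) (Φk (circleMap (c : ℂ) u θ'')) := by
    intro u hu
    have hu' : u ∈ Icc r (C * r) := Ioo_subset_Icc_self hu
    have hmu : m ≤ Dk u := csInf_le hSbdd ⟨u, hu, rfl⟩
    have hlt : d / 2 < Dk u := by
      have := hlow u hu'
      change Dk s₀ < 4 / 3 * m at hs₀m
      linarith
    have hex : ∃ p ∈ arc u '' Icc 0 π, ∃ q ∈ arc u '' Icc 0 π, d / 2 < dist p q := by
      by_contra hcon
      push Not at hcon
      exact (not_le.2 hlt) (Metric.diam_le_of_forall_dist_le (by positivity) hcon)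
    obtain ⟨_, ⟨θa, hθa, rfl⟩, _, ⟨θb, hθb, rfl⟩, hpq⟩ := hex
    set ε : ℝ := (dist (arc u θa) (arc u θb) - d / 2) / 3 with hε
    have hεpos : 0 < ε := by rw [hε]; linarith
    obtain ⟨θ', hθ', h1⟩ := exists_Ioo_dist_lt (harcc u hu') hθa hεpos
    obtain ⟨θ'', hθ'', h2⟩ := exists_Ioo_dist_lt (harcc u hu') hθb hεpos
    refine ⟨θ', hθ', θ'', hθ'', ?_⟩
    have h3 := dist_triangle4 (arc u θa) (arc u θ') (arc u θ'') (arc u θb)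
    rw [dist_comm] at h1
    change d / 2 ≤ dist (arc u θ') (arc u θ'')
    linarith
  -- the far cross-cut
  obtain ⟨u₁, hu₁, hfar⟩ := FarCrosscut.exists_forall_lt_dist hΦkdiff
    (hΦkinj.mono fun z (hz : 0 < z.im) ↦ hz.le) hr hC1 hdpos hC' hC hdiam x
  have hfar' : ∀ θ ∈ Icc (0 : ℝ) π, (C' + 1) * d ≤ dist (arc u₁ θ) x := fun θ hθ ↦
    le_of_forall_Ioo (h := fun θ ↦ dist (arc u₁ θ) x)
      (continuous_dist.comp_continuousOn
        ((harcc u₁ (Ioo_subset_Icc_self hu₁)).prodMk continuousOn_const)) hfar hθ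
  exact ⟨x, d, s₀, u₁, hdlow, hs₀, hu₁, ⟨π / 2, hπ2, rfl⟩, hin, hfar'⟩

end RoundAnnulus

/-- **Registered form** (anchor `faceAnnulus_eventually_exists_crosscuts` of stmt-CriticalPhenomena-0746, input (T1) of
`Driver.PercFaceAnnulusTransfer`): the near and the far level cross-cuts of the half-annuli `A(c; r, Cr) ∩ ℍ̄`, `|c| ≤ Z`,
through the approximating chordal maps, eventually, with inner radius bounded below.
[cite: KemppainenSmirnov2017, §2.2 (proof of Prop. 2.6, (G2) ⇒ (C2))] -/
theorem faceAnnulus_eventually_exists_crosscuts : ∀ {D : Literature.Probability.RandomPlanarGeometry.DobrushinDomain} (φ : Literature.Probability.RandomPlanarGeometry.ConformalEquiv UpperHalfPlane.upperHalfPlaneSet D.carrier) {Ds : ℕ → Literature.Probability.RandomPlanarGeometry.DobrushinDomain} (φs : ∀ k, Literature.Probability.RandomPlanarGeometry.ConformalEquiv UpperHalfPlane.upperHalfPlaneSet (Ds k).carrier), (∀ R : ℝ, TendstoUniformlyOn (fun k ↦ (φs k).boundaryExtension) φ.boundaryExtension Filter.atTop ({z : ℂ | 0 ≤ z.im} ∩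 Metric.closedBall 0 R)) → ∀ {r C C' : ℝ}, 0 < r → 1 < C → 0 ≤ C' → 2 * Real.pi ^ 2 / Real.log (4 / 3) + 36 * Real.pi ^ 2 * (C' + 1) ^ 2 < Real.log C → ∀ Z : ℝ, ∃ d₀ : ℝ, 0 < d₀ ∧ ∀ᶠ k in Filter.atTop, ∀ c : ℝ, |c| ≤ Z → ∃ (x : ℂ) (d s₀ u₁ : ℝ), d₀ ≤ d ∧ s₀ ∈ Set.Ioo r (C * r) ∧ u₁ ∈ Set.Ioo r (C * r) ∧ (∃ θ₀ ∈ Set.Ioo (0 : ℝ) Real.pi, x = (φs k).boundaryExtension (circleMap (c : ℂ) s₀ θ₀)) ∧ (∀ θ ∈ Set.Icc (0 : ℝ) Real.pi, dist ((φs k).boundaryExtension (circleMap (c : ℂ) s₀ θ)) x ≤ d) ∧ (∀ θ ∈ Set.Icc (0 : ℝ) Real.pi, (C' + 1) * d ≤ dist ((φs k).boundaryExtension (circleMap (c : ℂ) u₁ θ)) x) :=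
  fun φ _ φs hU1 _ _ _ hr hC1 hC' hC Z ↦ RoundAnnulus.eventually_exists_crosscuts φ φs hU1 hr hC1 hC' hC Z

end Summit.CriticalPhenomena.CardyFormulaZ2.Cruxes.CardyRigidity.CrossingMartingale

end
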